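import Summits.QuantumFields.YangMills.Theorems.BalabanUVNodesPortS1ChartDensityRecord
import Summits.QuantumFields.YangMills.Theorems.BalabanUVNodesPortS1ChartRem
import Summits.QuantumFields.YangMills.Theorems.BalabanUVNodesPortS1ChartBlind

/-!
# NODE O port PT-A — FE-1's chart law (T1), (B-★) part 1 of `Lines/pta_residueW-LOCATING-S1-Bstar-v2.md` §3–§4: N11's FIBRE INTEGRAND READ THROUGH THE OFF-CENTRAL PAULI CHART AT CENTRE
# `ctr W` IS THE SOLVED-FORM (2.10) INTEGRAND, POINTWISE IN THE REMAINING VARIABLES `y : NonB0Idx → ℝ` — the graph point `Y(W,y) = recordReparamOf … (ctr W) 1 (C·y)` is on the fibre with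
# loops `< α`, the chart fill is it resampled, the own-average read returns it with indicator `1`, ✓p838163 identifies each `jd_c`, and the support clause kills everything off `remWindow r`
# ([I] (2.10) p.267 «δ(Q̃(B′))» solved for `B′(b₀(c))`, p.268 L1–3)

Cell `ym-nodeO-ideate`, porter seat PT-A-1 (gen 14); `--kind proof --supports stmt-QuantumFields-27930 --as helper`; count-neutral.  [I] = [Balaban1987RG1]; [16] = [Balaban1985UV3].
Docket ★★★ director-ym №678 (2)(iii) ∕ №684 (2).  Over ✓`…PortS1ChartDensityRecord` (p838163), ✓`…ChartRem` (`fluctVecRem`), ✓`…ChartBlind`∕`…FibreGraphWindow`∕`…FibreGraphPoint`∕`…Coords`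
(graph point on the fibre, own-average read, blindness), ✓`…ChartJacobianPi`∕`…JacobianRecord` (`chartPi`, `pert_apply_eq_chartAt`).

WHAT IS PROVED (0 `def`, 0 `sorry`; `R := 1∕(10⁸dL)`, `ρD :=` the pinned `D̃`-radius at loop currency `αD`).  §1 `recordRem_graphPoint` (the graph point's remaining variables are `y`),
`fluctVecRem_eq_fluctVec_graphPoint`, `fill_chartPi_fluctVec_eq_extend` (the off-central Pauli chart filled with dummies = the configuration resampled), `norm_graphPoint_lt` (`‖Y‖ < R` inside the
`D̃`-ball), `loops_graphPoint_lt` (loops of `pert Vk Y` STRICTLY `< α` under the budget `αD + (d+2)L·(e^{3R} − 1) ≤ α`).  §2 ★★ `privateIntegrand_chart_eq_indicator_solved` — for `W` with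
`Ū(ctr W) = W`, loops `≤ αD`, any blind sharp bundle `(T, ϑ, jd, jac′)` (N11's clause shapes VERBATIM), dummies `U₀`, and `y ∈ remWindow π`:
`fluctSigma(fluctVecRem y) • 𝟙·Π_c jd_c(Ū′, W c)·ρ(extend β (ϑ_c(Ū′, W c))_c Ū′) = 𝟙_{remWindow r}(y) · fluctSigma(fluctVec Y) · (Π_c |det D_a q_c|)⁻¹ · ρ(pert (ctr W) Y)` — NO `σ₀` per bond
(STAR-FLAT-CHECK-v1 (C4)).

HONEST FRAMING.  Chart bookkeeping + landed bricks by name; the bundle, the `D̃`-ball condition `hCr`, the budget and the support clause are HYPOTHESES; the integral identity (★) is part 2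
(`…PortS1ChartLawStar`); (B-T2) NOT here; no Bałaban estimate asserted, ported or discharged; `FEChartLawReg`∕`FEPolymerActivitiesReg`∕`P0HolExtAtRecordGL`∕`ClassP2Reg`∕`RegSelSmoothOnClass`∕
`RegClassNestsUc` inhabited NOWHERE; ⟨27930⟩ OPEN 2∕7 · no claim; NODE O 0∕1; COUNT 8∕28 · K 1∕4 · legs 0∕6 UNMOVED; finite `𝕋⁴_{L^K}` at fixed ε — NOT continuum ∕ OS; **the Yang–Mills
mass gap (Clay) is NOT proved by any of this.**  No `sorry`, no `def`, no `instance`; standard axioms only.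
-/

noncomputable section

open MeasureTheory MeasureTheory.Measure Set Metric Function Filter Topology
open scoped ENNReal NNReal BigOperators Matrix.Norms.L2Operator

namespace Summit.QuantumFields.YangMills.Theorems.BalabanUVNodesPortS1

open Literature.MathematicalPhysics.QuantumFieldTheory (haarProbability)
open Literature.MathematicalPhysics.QuantumFieldTheory.Balaban1983to89
open Literature.MathematicalPhysics.QuantumFieldTheory.Balaban1983to89.Node00
open Literature.MathematicalPhysics.QuantumFieldTheory.Balaban1983to89.T4Continuum (T4Family)
open Literature.MathematicalPhysics.QuantumFieldTheory.Balaban1983to89.B10Eq22Rescaling (sigmaSU2 sigmaSU2_zero)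
open Literature.MathematicalPhysics.QuantumFieldTheory.Balaban1983to89.B10Eq18SigmaSU2Haar
open Literature.MathematicalPhysics.QuantumFieldTheory.Balaban1983to89.BlockAveraging (avgFun loopHol Small Idx)
open Literature.MathematicalPhysics.QuantumFieldTheory.Balaban1983to89.BlockAveragingHaarAC (centralBond pre post centralBond_injective)
open Literature.MathematicalPhysics.QuantumFieldTheory.Balaban1983to89.BlockAveragingEMLHaarAC (fibreFamily offCard)
open Literature.MathematicalPhysics.QuantumFieldTheory.Balaban1983to89.ExpMeanLog (expMeanLogSU deltaSU)
open Summit.QuantumFields.YangMills.Theorems.K0RecordFormatNames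
open Summit.QuantumFields.YangMills.Theorems.BalabanUVNodesN11TransportOfRecordInPrivateCoordinateChart (succ_le_m_add_K measurable_privateChart measurable_privateJacobian)
open _root_.Matrix

variable (F : T4Family)

/-! ## §1  The graph point: remaining variables, chart fill, norm, loops -/

section GraphPoint

variable {F}

/-- The remaining variables of the graph point `Y = recordReparamOf … Vk 1 (C·y)` are `y` itself (✓`recordReparamOf_recordCopFluct_apply_of_not_mem` at `g = 1`). [cite: Balaban1987RG1, p.268 («B′ = CB»)] -/
theorem recordRem_graphPoint {K k : ℕ} (Dt : GaugeField (F.P K) k (SU 2) → (FluctIdx F k K → ℂ) → (PBond (F.P K) (k + 1) → MatA 2)) (Vk : GaugeField (F.P K) k (SU 2))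
    (y : NonB0Idx F k K → ℝ) : recordRem F k (recordReparamOf F k Dt Vk 1 (recordCopFluct F k K Vk *ᵥ y)) = y := by
  funext i
  rw [recordRem, recordReparamOf_recordCopFluct_apply_of_not_mem, one_mul]

/-- Hence the off-central bond vectors of the graph point are those of `y`: `fluctVecRem y = (b ↦ fluctVec Y b)`. [cite: Balaban1987RG1, p.268 (bookkeeping)] -/
theorem fluctVecRem_eq_fluctVec_graphPoint {K k : ℕ} (Dt : GaugeField (F.P K) k (SU 2) → (FluctIdx F k K → ℂ) → (PBond (F.P K) (k + 1) → MatA 2)) (Vk : GaugeField (F.P K) k (SU 2))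
    (y : NonB0Idx F k K → ℝ) :
    fluctVecRem F k K y = fun b => fluctVec F k K (recordReparamOf F k Dt Vk 1 (recordCopFluct F k K Vk *ᵥ y)) b.1 := by
  rw [← fluctVecRem_recordRem, recordRem_graphPoint]

/-- ★ **THE OFF-CENTRAL PAULI CHART FILLED WITH DUMMIES IS THE CONFIGURATION RESAMPLED**: for any `x`, filling the central bonds of `(b ∉ β) ↦ chartAt (Vk b) (fluctVec x b)` with `U₀` gives
`extend β (U₀ ∘ β) (pert Vk x)` (✓`ext_off_eq_extend`, ✓`pert_apply_eq_chartAt`). [cite: Balaban1987RG1, (2.4) p.266, (2.10) p.267 (bookkeeping)] -/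
theorem fill_chartPi_fluctVec_eq_extend {K k : ℕ} (hk : k < K) (Vk U₀ : GaugeField (F.P K) k (SU 2)) (x : FluctIdx F k K → ℝ) :
    (fun b => if h : b ∈ Set.range (centralBond : PBond (F.P K) (k + 1) → PBond (F.P K) k) then U₀ b
      else chartPi (fun b' : {b : PBond (F.P K) k // ¬ b ∈ Set.range (centralBond : PBond (F.P K) (k + 1) → PBond (F.P K) k)} => Vk b'.1)
        (fun b' => fluctVec F k K x b'.1) ⟨b, h⟩) =
      extend centralBond (fun c => U₀ (centralBond c)) (pert F k K Vk x) := by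
  have hβ : Injective (centralBond : PBond (F.P K) (k + 1) → PBond (F.P K) k) := centralBond_injective (succ_le_m_add_K hk)
  funext b
  by_cases h : ∃ c, centralBond c = b
  · obtain ⟨c, rfl⟩ := h
    rw [dif_pos ⟨c, rfl⟩, hβ.extend_apply]
  · rw [dif_neg (fun ⟨c, hc⟩ => h ⟨c, hc⟩), extend_apply' _ _ _ h, chartPi_apply, pert_apply_eq_chartAt, chartAt_apply]

variable {K k : ℕ} (hk : k < K) (Vk : GaugeField (F.P K) k (SU 2)) {αD : ℝ}
  (hαD : ∀ (c : PBond (F.P K) (k + 1)) (i : Idx (F.P K)), dist1 (loopHol Vk c i) ≤ αD) (hαDL : 157 * αD < (((F.P K).L : ℝ) ^ ((F.P K).d - 1))⁻¹)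
  (y : NonB0Idx F k K → ℝ)
  (hgy : ‖(fun i => ((((1 : ℝ) • (recordCopFluct F k K Vk *ᵥ y)) i : ℝ) : ℂ))‖ <
    min ((1 : ℝ) / (10 ^ 8 * (F.P K).d * (F.P K).L) / 3) (1 / (18 * (2 * 1 / (1 / (10 ^ 8 * (F.P K).d * (F.P K).L)) ^ 2) * ((6 / ((((F.P K).L : ℝ) ^ ((F.P K).d - 1))⁻¹ - 157 * αD)) + 1))))

include hk hαD hαDL hgy in
/-- ★ **THE GRAPH POINT LIES IN THE `R`-BALL** (`R = 1∕(10⁸dL)`): `‖Y‖ < R` inside the `D̃`-ball (✓`norm_ofReal_recordReparamOf_recordDt_lt`: `‖↑Y‖ < 2ρD ≤ 2R∕3`). [cite: Balaban1987RG1, p.267] -/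
theorem norm_graphPoint_lt :
    ‖recordReparamOf F k (fun Vk => recordDt F k K Vk (min ((1 : ℝ) / (10 ^ 8 * (F.P K).d * (F.P K).L) / 3)
        (1 / (18 * (2 * 1 / (1 / (10 ^ 8 * (F.P K).d * (F.P K).L)) ^ 2) * ((6 / ((((F.P K).L : ℝ) ^ ((F.P K).d - 1))⁻¹ - 157 * αD)) + 1)))))
        Vk 1 (recordCopFluct F k K Vk *ᵥ y)‖ < 1 / (10 ^ 8 * (F.P K).d * (F.P K).L) := by
  have hkr : k + 1 ≤ (F.P K).m + (F.P K).K := succ_le_m_add_K hk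
  have hα50 : αD ≤ 1 / 50 := alpha_le_fiftieth_of_lt F K hαDL
  have hα24 : αD ≤ 1 / 24 := hα50.trans (by norm_num)
  have hθ : 0 < (((F.P K).L : ℝ) ^ ((F.P K).d - 1))⁻¹ - 157 * αD := sub_pos.2 hαDL
  have hb : (0 : ℝ) ≤ 6 / ((((F.P K).L : ℝ) ^ ((F.P K).d - 1))⁻¹ - 157 * αD) := by positivity
  have hd : (1 : ℝ) ≤ (F.P K).d := by exact_mod_cast (F.P K).hd
  have hL : (1 : ℝ) ≤ (F.P K).L := by exact_mod_cast (F.P K).hL.2.le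
  have hR : (0 : ℝ) < 1 / (10 ^ 8 * (F.P K).d * (F.P K).L) := by positivity
  have hC₂ : (0 : ℝ) < 2 * 1 / (1 / (10 ^ 8 * (F.P K).d * (F.P K).L)) ^ 2 := by positivity
  obtain ⟨_, hq, h3⟩ := recordDt_smallness_of_radius hR hC₂ hb
  have hε := norm_loopM_sub_one_le_of_dist1 F Vk hαD
  have hVk := small_of_dist1_le F Vk hαD hα50
  have hHop := norm_hopLinGraphC_le F k K hkr Vk hαD hα24 hαDL
  have hY2 := norm_ofReal_recordReparamOf_recordDt_lt hkr Vk hε hα50 hVk hb hHop hq h3 1 (recordCopFluct F k K Vk *ᵥ y) hgy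
  rw [← norm_ofReal_pi_eq]
  linarith [norm_nonneg (fun i => ((((1 : ℝ) • (recordCopFluct F k K Vk *ᵥ y)) i : ℝ) : ℂ))]

include hk hαD hαDL hgy in
/-- ★ **THE LOOPS OF THE GRAPH CONFIGURATION ARE STRICTLY α-SMALL** under the budget `αD + (d+2)L·(e^{3R} − 1) ≤ α` (✓`dist1_loopHol_pert_le` + `‖Y‖ < R`). [cite: Balaban1987RG1, (2.4) p.266, (2.9) p.266] -/
theorem loops_graphPoint_lt {α : ℝ}
    (hbudget : αD + ((((F.P K).d + 2) * (F.P K).L : ℕ) : ℝ) * (Real.exp (3 * (1 / (10 ^ 8 * (F.P K).d * (F.P K).L))) - 1) ≤ α)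
    (c : PBond (F.P K) (k + 1)) (i : Idx (F.P K)) :
    dist1 (loopHol (pert F k K Vk (recordReparamOf F k (fun Vk => recordDt F k K Vk (min ((1 : ℝ) / (10 ^ 8 * (F.P K).d * (F.P K).L) / 3)
        (1 / (18 * (2 * 1 / (1 / (10 ^ 8 * (F.P K).d * (F.P K).L)) ^ 2) * ((6 / ((((F.P K).L : ℝ) ^ ((F.P K).d - 1))⁻¹ - 157 * αD)) + 1)))))
        Vk 1 (recordCopFluct F k K Vk *ᵥ y))) c i) < α := by
  have hY := norm_graphPoint_lt hk Vk hαD hαDL y hgy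
  have hdL : (0 : ℝ) < ((((F.P K).d + 2) * (F.P K).L : ℕ) : ℝ) := by
    have hL : 0 < (F.P K).L := lt_trans zero_lt_one (F.P K).hL.2
    positivity
  refine lt_of_le_of_lt (dist1_loopHol_pert_le F k K Vk _ c i) (lt_of_lt_of_le ?_ hbudget)
  have hexp : Real.exp (3 * ‖recordReparamOf F k (fun Vk => recordDt F k K Vk (min ((1 : ℝ) / (10 ^ 8 * (F.P K).d * (F.P K).L) / 3)
        (1 / (18 * (2 * 1 / (1 / (10 ^ 8 * (F.P K).d * (F.P K).L)) ^ 2) * ((6 / ((((F.P K).L : ℝ) ^ ((F.P K).d - 1))⁻¹ - 157 * αD)) + 1)))))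
        Vk 1 (recordCopFluct F k K Vk *ᵥ y)‖) < Real.exp (3 * (1 / (10 ^ 8 * (F.P K).d * (F.P K).L))) := Real.exp_lt_exp.2 (by linarith)
  have := mul_lt_mul_of_pos_left (sub_lt_sub_right hexp 1) hdL
  linarith [hαD c i]

end GraphPoint


/-! ## §2  The fibre integrand read through the off-central Pauli chart, pointwise in the remaining variables -/

section Pointwise

variable {F}

/-- ★★ **N11's FIBRE INTEGRAND, READ THROUGH THE OFF-CENTRAL PAULI CHART AT CENTRE `ctr W`, IS THE SOLVED-FORM INTEGRAND — POINTWISE IN `y ∈ remWindow π`.**  For `W` with `Ū(ctr W) = W` and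
loops `≤ αD`, under (B1)∕(B2)∕(S) and for any blind sharp bundle `(T, ϑ, jd, jac′)` (N11's clauses) and dummies `U₀`:
`fluctSigma(fluctVecRem y) • 𝟙[∀c, W c ∈ T_c Ū′]·Π_c jd_c(Ū′, W c)·ρ(extend β (ϑ_c(Ū′, W c))_c Ū′) = 𝟙_{remWindow r}(y) · fluctSigma(fluctVec Y) · (Π_c |det_c|)⁻¹ · ρ(pert (ctr W) Y)`,
`Ū′ := fill_{U₀}(chartPi (ctr W|off) (fluctVecRem y))`, `Y := recordReparamOf … (ctr W) 1 (C·y)`.  (Off `remWindow r` the support clause kills the left side; on it the graph point is on the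
fibre with loops `< α`, `Ū′` is `pert (ctr W) Y` resampled, the own-average read returns it with indicator `1`, and ✓p838163 identifies each `jd_c`.) [cite: Balaban1987RG1, (2.10) p.267, p.268 L1–3, (2.4) p.266, (2.9) p.266] -/
theorem privateIntegrand_chart_eq_indicator_solved {K k : ℕ} (hk : k < K) {α αD r ρD : ℝ}
    (hαDL : 157 * αD < (((F.P K).L : ℝ) ^ ((F.P K).d - 1))⁻¹)
    (hbudget : αD + ((((F.P K).d + 2) * (F.P K).L : ℕ) : ℝ) * (Real.exp (3 * (1 / (10 ^ 8 * (F.P K).d * (F.P K).L))) - 1) ≤ α)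
    (hrR : r ≤ 1 / (10 ^ 8 * (F.P K).d * (F.P K).L))
    (hρD : ρD = (min ((1 : ℝ) / (10 ^ 8 * (F.P K).d * (F.P K).L) / 3) (1 / (18 * (2 * 1 / (1 / (10 ^ 8 * (F.P K).d * (F.P K).L)) ^ 2) * ((6 / ((((F.P K).L : ℝ) ^ ((F.P K).d - 1))⁻¹ - 157 * αD)) + 1)))))
    {T : PBond (F.P K) (k + 1) → GaugeField (F.P K) k (SU 2) → Set (SU 2)}
    {ϑ : PBond (F.P K) (k + 1) → GaugeField (F.P K) k (SU 2) → SU 2 → SU 2}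
    {jd jac' : PBond (F.P K) (k + 1) → GaugeField (F.P K) k (SU 2) → SU 2 → ℝ≥0}
    (hjacm : ∀ c, Measurable fun p : GaugeField (F.P K) k (SU 2) × SU 2 => jac' c p.1 p.2)
    (hright : ∀ c U, ∀ v ∈ T c U, (avOfRecord F 2 K k).avg (update U (centralBond c) (ϑ c U v)) c = v)
    (hTim : ∀ c U, T c U = (fun g => (avOfRecord F 2 K k).avg (update U (centralBond c) g) c) ''
      {g : SU 2 | ∀ i : Idx (F.P K), dist1 (fibreFamily U c (pre U c * g * post U c) i) ≤ α})
    (hleft : ∀ c U g, (∀ i : Idx (F.P K), dist1 (fibreFamily U c (pre U c * g * post U c) i) ≤ α) →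
      ϑ c U ((avOfRecord F 2 K k).avg (update U (centralBond c) g) c) = g)
    (hQ : ∀ c U v, jd c U v = (jac' c U (ϑ c U v))⁻¹)
    (hjac0 : ∀ c U g, (∀ i : Idx (F.P K), dist1 (fibreFamily U c (pre U c * g * post U c) i) ≤ α) → jac' c U g ≠ 0)
    (hfwd : ∀ c U, (HaarData.haar : Measure (SU 2)).restrict
        ((fun g => (avOfRecord F 2 K k).avg (update U (centralBond c) g) c) ''
          {g : SU 2 | ∀ i : Idx (F.P K), dist1 (fibreFamily U c (pre U c * g * post U c) i) ≤ α}) =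
      (((HaarData.haar : Measure (SU 2)).restrict {g : SU 2 | ∀ i : Idx (F.P K), dist1 (fibreFamily U c (pre U c * g * post U c) i) ≤ α}).withDensity
          fun g => (jac' c U g : ℝ≥0∞)).map (fun g => (avOfRecord F 2 K k).avg (update U (centralBond c) g) c))
    (hjacc : ∀ c U, ContinuousOn (jac' c U) {g : SU 2 | ∀ i : Idx (F.P K), dist1 (fibreFamily U c (pre U c * g * post U c) i) ≤ α})
    (hTbl : ∀ c U (g : PBond (F.P K) (k + 1) → SU 2), T c (extend centralBond g U) = T c U)
    (hθbl : ∀ c U (g : PBond (F.P K) (k + 1) → SU 2), ϑ c (extend centralBond g U) = ϑ c U)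
    (hjbl : ∀ c U (g : PBond (F.P K) (k + 1) → SU 2), jd c (extend centralBond g U) = jd c U)
    (ctr : (PBond (F.P K) (k + 1) → SU 2) → GaugeField (F.P K) k (SU 2)) {W : PBond (F.P K) (k + 1) → SU 2}
    (hW : (avOfRecord F 2 K k).avg (ctr W) = W) (hWD : ∀ (c : PBond (F.P K) (k + 1)) (i : Idx (F.P K)), dist1 (loopHol (ctr W) c i) ≤ αD)
    (hCr : ∀ y : NonB0Idx F k K → ℝ, (∀ (b : PBond (F.P K) k) (hb : b ∉ Set.range (recordB0 F k K)), √(∑ a : Fin 3, y ⟨(b, a), hb⟩ ^ 2) < r) →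
      ‖(fun i => ((((1 : ℝ) • (recordCopFluct F k K (ctr W) *ᵥ y)) i : ℝ) : ℂ))‖ < ρD)
    {ρ : Density (F.P K) k (SU 2)}
    (hS : ∀ U, ρ U ≠ 0 → (∀ (c : PBond (F.P K) (k + 1)) (i : Idx (F.P K)), dist1 (loopHol U c i) < α) ∧
      ∃ x : FluctIdx F k K → ℝ, (∀ b, ‖fluctVec F k K x b‖ < r) ∧ U = pert F k K (ctr ((avOfRecord F 2 K k).avg U)) x)
    (U₀ : GaugeField (F.P K) k (SU 2)) (y : NonB0Idx F k K → ℝ)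
    (hy : ∀ (b : PBond (F.P K) k) (hb : b ∉ Set.range (recordB0 F k K)), √(∑ a : Fin 3, y ⟨(b, a), hb⟩ ^ 2) < Real.pi) :
    fluctSigma (fluctVecRem F k K y) •
      ((({p : GaugeField (F.P K) (k + 1) (SU 2) × GaugeField (F.P K) k (SU 2) | ∀ c, p.1 c ∈ T c p.2}.indicator (fun p => ∏ c, jd c p.2 (p.1 c))
          (W, (fun b => if h : b ∈ Set.range (centralBond : PBond (F.P K) (k + 1) → PBond (F.P K) k) then U₀ b
            else chartPi (fun b' : {b : PBond (F.P K) k // ¬ b ∈ Set.range (centralBond : PBond (F.P K) (k + 1) → PBond (F.P K) k)} => ctr W b'.1)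
              (fluctVecRem F k K y) ⟨b, h⟩)) : ℝ≥0) : ℝ) *
        ρ (extend centralBond
          (fun c => ϑ c (fun b => if h : b ∈ Set.range (centralBond : PBond (F.P K) (k + 1) → PBond (F.P K) k) then U₀ b
            else chartPi (fun b' : {b : PBond (F.P K) k // ¬ b ∈ Set.range (centralBond : PBond (F.P K) (k + 1) → PBond (F.P K) k)} => ctr W b'.1)
              (fluctVecRem F k K y) ⟨b, h⟩) (W c))
          (fun b => if h : b ∈ Set.range (centralBond : PBond (F.P K) (k + 1) → PBond (F.P K) k) then U₀ b
            else chartPi (fun b' : {b : PBond (F.P K) k // ¬ b ∈ Set.range (centralBond : PBond (F.P K) (k + 1) → PBond (F.P K) k)} => ctr W b'.1)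
              (fluctVecRem F k K y) ⟨b, h⟩))) =
      {y : NonB0Idx F k K → ℝ | ∀ (b : PBond (F.P K) k) (hb : b ∉ Set.range (recordB0 F k K)), √(∑ a : Fin 3, y ⟨(b, a), hb⟩ ^ 2) < r}.indicator
        (fun y => fluctSigma (fluctVec F k K (recordReparamOf F k (fun Vk => recordDt F k K Vk ρD) (ctr W) 1 (recordCopFluct F k K (ctr W) *ᵥ y))) *
          ((∏ c : PBond (F.P K) (k + 1),
              |(fderiv ℝ (fun a : EuclideanSpace ℝ (Fin 3) =>
                  (WithLp.toLp 2 (su2Coord (recordQt F k K (ctr W) ((fluctVec F k K).symm (update (fluctVec F k K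
                    (recordReparamOf F k (fun Vk => recordDt F k K Vk ρD) (ctr W) 1 (recordCopFluct F k K (ctr W) *ᵥ y))) (centralBond c) a)) c)) : EuclideanSpace ℝ (Fin 3)))
                (fluctVec F k K (recordReparamOf F k (fun Vk => recordDt F k K Vk ρD) (ctr W) 1 (recordCopFluct F k K (ctr W) *ᵥ y)) (centralBond c))).det|)⁻¹ *
            ρ (pert F k K (ctr W) (recordReparamOf F k (fun Vk => recordDt F k K Vk ρD) (ctr W) 1 (recordCopFluct F k K (ctr W) *ᵥ y))))) y := by
  subst hρD
  have hkr : k + 1 ≤ (F.P K).m + (F.P K).K := succ_le_m_add_K hk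
  have hβ : Injective (centralBond : PBond (F.P K) (k + 1) → PBond (F.P K) k) := centralBond_injective hkr
  have hd : (1 : ℝ) ≤ (F.P K).d := by exact_mod_cast (F.P K).hd
  have hL : (1 : ℝ) ≤ (F.P K).L := by exact_mod_cast (F.P K).hL.2.le
  have hRle : (1 : ℝ) / (10 ^ 8 * (F.P K).d * (F.P K).L) ≤ 1 / 10 ^ 8 := one_div_le_one_div_of_le (by positivity) (by nlinarith)
  have hrπ : r < Real.pi := by linarith [hrR.trans hRle, Real.pi_gt_three]
  -- names
  set Yg := recordReparamOf F k (fun Vk => recordDt F k K Vk (min ((1 : ℝ) / (10 ^ 8 * (F.P K).d * (F.P K).L) / 3) (1 / (18 * (2 * 1 / (1 / (10 ^ 8 * (F.P K).d * (F.P K).L)) ^ 2) * ((6 / ((((F.P K).L : ℝ) ^ ((F.P K).d - 1))⁻¹ - 157 * αD)) + 1))))) (ctr W) 1 (recordCopFluct F k K (ctr W) *ᵥ y) with hYg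
  set Ubar : GaugeField (F.P K) k (SU 2) := fun b => if h : b ∈ Set.range (centralBond : PBond (F.P K) (k + 1) → PBond (F.P K) k) then U₀ b
    else chartPi (fun b' : {b : PBond (F.P K) k // ¬ b ∈ Set.range (centralBond : PBond (F.P K) (k + 1) → PBond (F.P K) k)} => ctr W b'.1)
      (fluctVecRem F k K y) ⟨b, h⟩ with hUbar
  -- the chart fill off the central bonds
  have hUbar_off : ∀ (b : PBond (F.P K) k) (hb : b ∉ Set.range (recordB0 F k K)), Ubar b = chartAt (ctr W b) (fluctVecRem F k K y ⟨b, hb⟩) := by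
    intro b hb
    have hb' : ¬ b ∈ Set.range (centralBond : PBond (F.P K) (k + 1) → PBond (F.P K) k) := hb
    rw [hUbar]; dsimp only
    rw [dif_neg hb', chartPi_apply, chartAt_apply]
    rfl
  by_cases hyr : y ∈ {y : NonB0Idx F k K → ℝ | ∀ (b : PBond (F.P K) k) (hb : b ∉ Set.range (recordB0 F k K)), √(∑ a : Fin 3, y ⟨(b, a), hb⟩ ^ 2) < r}
  · -- ON THE WINDOW: the graph point is on the fibre with loops `< α`; `Ubar` is it resampled
    rw [Set.indicator_of_mem hyr]
    have hgy := hCr y hyr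
    have havg : ∀ c, (avOfRecord F 2 K k).avg (pert F k K (ctr W) Yg) c = (avOfRecord F 2 K k).avg (ctr W) c :=
      fun c => avg_pert_recordReparamOf_recordCopFluct_eq hkr (ctr W) hWD hαDL 1 y hgy c
    have hY : ‖Yg‖ < 1 / (10 ^ 8 * (F.P K).d * (F.P K).L) := norm_graphPoint_lt hk (ctr W) hWD hαDL y hgy
    have hloops : ∀ (c : PBond (F.P K) (k + 1)) (i : Idx (F.P K)), dist1 (loopHol (pert F k K (ctr W) Yg) c i) < α :=
      fun c i => loops_graphPoint_lt hk (ctr W) hWD hαDL y hgy hbudget c i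
    have hbud : ∀ (c : PBond (F.P K) (k + 1)) (i : Idx (F.P K)),
        dist1 (loopHol (ctr W) c i) + ((((F.P K).d + 2) * (F.P K).L : ℕ) : ℝ) * (Real.exp (3 * ‖Yg‖) - 1) ≤ α := by
      intro c i
      have hdL : (0 : ℝ) ≤ ((((F.P K).d + 2) * (F.P K).L : ℕ) : ℝ) := by positivity
      have hexp : Real.exp (3 * ‖Yg‖) ≤ Real.exp (3 * (1 / (10 ^ 8 * (F.P K).d * (F.P K).L))) := Real.exp_le_exp.2 (by linarith)
      have := mul_le_mul_of_nonneg_left (sub_le_sub_right hexp 1) hdL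
      linarith [hWD c i]
    have hfill : Ubar = extend centralBond (fun c => U₀ (centralBond c)) (pert F k K (ctr W) Yg) := by
      rw [hUbar, fluctVecRem_eq_fluctVec_graphPoint (fun Vk => recordDt F k K Vk (min ((1 : ℝ) / (10 ^ 8 * (F.P K).d * (F.P K).L) / 3) (1 / (18 * (2 * 1 / (1 / (10 ^ 8 * (F.P K).d * (F.P K).L)) ^ 2) * ((6 / ((((F.P K).L : ℝ) ^ ((F.P K).d - 1))⁻¹ - 157 * αD)) + 1))))) (ctr W) y]
      exact fill_chartPi_fluctVec_eq_extend hk (ctr W) U₀ Yg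
    obtain ⟨hmem, hΨ⟩ := privateChart_at_avg_graphPoint_eq F hk hTim hTbl hleft hθbl (ctr W) Yg U₀ havg hbud
    rw [← hfill] at hmem hΨ
    simp only [hW] at hmem hΨ
    -- the indicator is `1` and `Ψ` is the graph configuration
    have hS_mem : ((W, Ubar) : GaugeField (F.P K) (k + 1) (SU 2) × GaugeField (F.P K) k (SU 2)) ∈
        {p : GaugeField (F.P K) (k + 1) (SU 2) × GaugeField (F.P K) k (SU 2) | ∀ c, p.1 c ∈ T c p.2} := hmem
    rw [Set.indicator_of_mem hS_mem, hΨ, NNReal.coe_prod]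
    -- per bond: `jd_c(Ubar, W c) = chartJac(Y_{βc}) ∕ |det_c|`
    have hjd : ∀ c, (jd c Ubar (W c) : ℝ) = chartJac (fluctVec F k K Yg (centralBond c)) /
        |(fderiv ℝ (fun a : EuclideanSpace ℝ (Fin 3) =>
            (WithLp.toLp 2 (su2Coord (recordQt F k K (ctr W) ((fluctVec F k K).symm (update (fluctVec F k K Yg) (centralBond c) a)) c)) : EuclideanSpace ℝ (Fin 3)))
          (fluctVec F k K Yg (centralBond c))).det| := by
      intro c
      rw [hfill, hjbl, ← congrFun hW c]
      exact (jd_eq_chartJac_div_abs_det_of_fibrePoint hk (ctr W) hWD hαDL Yg hY c (havg c) (hloops c)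
        ((hjacm c).comp (measurable_const.prodMk measurable_id)) (hfwd c _) (hjacc c _) (hjac0 c _) (hleft c _) (hQ c _)).2
    simp_rw [hjd]
    -- the Jacobians: `Π_{b∉β} chartJac(y_b) · Π_c chartJac(Y_{βc}) = fluctSigma (fluctVec Y)`
    have hσ : fluctSigma (fluctVecRem F k K y) * ∏ c, chartJac (fluctVec F k K Yg (centralBond c)) = fluctSigma (fluctVec F k K Yg) := by
      rw [fluctVecRem_eq_fluctVec_graphPoint (fun Vk => recordDt F k K Vk (min ((1 : ℝ) / (10 ^ 8 * (F.P K).d * (F.P K).L) / 3) (1 / (18 * (2 * 1 / (1 / (10 ^ 8 * (F.P K).d * (F.P K).L)) ^ 2) * ((6 / ((((F.P K).L : ℝ) ^ ((F.P K).d - 1))⁻¹ - 157 * αD)) + 1))))) (ctr W) y]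
      unfold fluctSigma
      classical
      have hsplit := (Finset.prod_mul_prod_compl (Finset.univ.image (centralBond : PBond (F.P K) (k + 1) → PBond (F.P K) k))
        (fun b => chartJac (fluctVec F k K Yg b))).symm
      have himg : ∏ b ∈ Finset.univ.image (centralBond : PBond (F.P K) (k + 1) → PBond (F.P K) k), chartJac (fluctVec F k K Yg b) =
          ∏ c, chartJac (fluctVec F k K Yg (centralBond c)) := Finset.prod_image fun c _ c' _ h => hβ h
      have hcompl : ∏ b ∈ (Finset.univ.image (centralBond : PBond (F.P K) (k + 1) → PBond (F.P K) k))ᶜ, chartJac (fluctVec F k K Yg b) =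
          ∏ b' : {b : PBond (F.P K) k // b ∉ Set.range (recordB0 F k K)}, chartJac (fluctVec F k K Yg b'.1) :=
        Finset.prod_subtype _ (fun b => by simp [recordB0]) (fun b => chartJac (fluctVec F k K Yg b))
      rw [hsplit, himg, hcompl, mul_comm]
    rw [Finset.prod_div_distrib, smul_eq_mul, ← hσ, div_eq_mul_inv]
    ring
  · -- OFF THE WINDOW: the support clause kills the integrand
    rw [Set.indicator_of_notMem hyr, smul_eq_mul]
    refine mul_eq_zero_of_right _ ?_
    by_contra hne
    have hind : ((W, Ubar) : GaugeField (F.P K) (k + 1) (SU 2) × GaugeField (F.P K) k (SU 2)) ∈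
        {p : GaugeField (F.P K) (k + 1) (SU 2) × GaugeField (F.P K) k (SU 2) | ∀ c, p.1 c ∈ T c p.2} := by
      by_contra hnot
      exact hne (by rw [Set.indicator_of_notMem hnot, NNReal.coe_zero, zero_mul])
    have hρne : ρ (extend centralBond (fun c => ϑ c Ubar (W c)) Ubar) ≠ 0 := fun h0 => hne (by rw [h0, mul_zero])
    set Ψ : GaugeField (F.P K) k (SU 2) := extend centralBond (fun c => ϑ c Ubar (W c)) Ubar with hΨdef
    -- `Ū(Ψ) = W` by `hright`, bond by bond (private bonds)
    have havgΨ : (avOfRecord F 2 K k).avg Ψ = W := by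
      funext c
      have hupd : update Ψ (centralBond c) (ϑ c Ubar (W c)) = Ψ := by
        rw [hΨdef]
        conv_rhs => rw [← update_eq_self (centralBond c) (extend centralBond (fun c => ϑ c Ubar (W c)) Ubar)]
        rw [hβ.extend_apply]
      rw [← hupd, hΨdef, avg_update_centralBond_extend hk Ubar c _ (ϑ c Ubar (W c))]
      exact hright c Ubar (W c) (hind c)
    obtain ⟨-, x, hx, hΨx⟩ := hS Ψ hρne
    rw [havgΨ] at hΨx
    refine hyr fun b hb => ?_
    have hnb : ¬ ∃ c, centralBond c = b := fun ⟨c, hc⟩ => hb ⟨c, hc⟩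
    have h1 : Ψ b = chartAt (ctr W b) (fluctVecRem F k K y ⟨b, hb⟩) := by
      rw [hΨdef, extend_apply' _ _ _ hnb, hUbar_off b hb]
    have h2 : Ψ b = chartAt (ctr W b) (fluctVec F k K x b) := by rw [hΨx, pert_apply_eq_chartAt]
    have hyπ : fluctVecRem F k K y ⟨b, hb⟩ ∈ ball (0 : EuclideanSpace ℝ (Fin 3)) Real.pi := by
      rw [mem_ball_zero_iff, norm_fluctVecRem_apply]; exact hy b hb
    have hxπ : fluctVec F k K x b ∈ ball (0 : EuclideanSpace ℝ (Fin 3)) Real.pi := by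
      rw [mem_ball_zero_iff]; exact (hx b).trans hrπ
    have heq : fluctVecRem F k K y ⟨b, hb⟩ = fluctVec F k K x b := injOn_chartAt (ctr W b) hyπ hxπ (h1.symm.trans h2)
    calc √(∑ a : Fin 3, y ⟨(b, a), hb⟩ ^ 2) = ‖fluctVecRem F k K y ⟨b, hb⟩‖ := (norm_fluctVecRem_apply F k K y ⟨b, hb⟩).symm
      _ = ‖fluctVec F k K x b‖ := by rw [heq]
      _ < r := hx b

end Pointwise


end Summit.QuantumFields.YangMills.Theorems.BalabanUVNodesPortS1

end
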